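import Summits.QuantumFields.YangMills.Theorems.UnitScaleTiltProp7CoarseGramInverseDecay
import Summits.QuantumFields.YangMills.Theorems.UnitScaleTiltProp7BlockDistanceWeights
import HarnessLib

/-!
# Route `UnitScaleTilt`, crux K1 «MinimiserStabilityRegPr» (stmt-QuantumFields-19200), EX row `hGF[Lift]` ∕ `h349[Lift]` (curved member) — **LOD LINE BRICK (L5′-member), FILE B2c
# (routeR-w2 g12, LOCATE-L5-GRAMSHELLS 7416633c road (G), chair-adopted 22:38:36Z): THE INVERSE COARSE GRAM MATRIX OF THE MASSIVE SPIKE COLUMNS DECAYS EXPONENTIALLY IN THE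
# COARSE TORUS DISTANCE — `‖M⁻¹ i i′‖ ≤ (m_B²∕2 − 3ε(μ)²)⁻¹·e^{9μ}·e^{−μ·tdist(σ i, σ i′)}` for every slope `μ ≥ 0` inside the window — by ✓B2b `norm_gram_inv_le_exp_neg_weight` at
# px17's site⊗entry spike bases (✓`orthonormal_spike`) and px12's block-distance Agmon weights (✓B3 `exists_blockDistanceWeight`).**

Cell `ym3-torus` (HUMAN RULING D-0037, YM ladder rung R3 — NOT d = 4, NOT infinite volume, NOT a mass gap, NOT Clay).  Width seat `ym-routeR-w2` gen 12 (D-0154 (3c); ★p1 g24 22:38:36Z ∕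
23:28:16Z; ★★OWNER RULINGS №33∕№35).  THEOREMS ONLY (0 `def`, 0 `sorry`); px5 g11's member letters VERBATIM + `G hAG hGA`; `--supports stmt-QuantumFields-19200 --as helper`, count-neutral.
HONEST LABEL (№33 (6)): curved γ-row ∕ (3.49) supplier line (LOD localisation), the `hN` row of ✓`norm_form_sandwich_le_exp` ∕ ✓`norm_inner_starProjection_le_exp` for print's
complementary projector in the massive spike columns; CONDITIONAL on the coarse coercivity `hcoer` ((L4′), px10 g9's knit) and on the window hypotheses `hδ`∕`hwin`∕`hgap` (the
consumer's choice of `μ`); nothing of (3.49), Thm 3.1∕3.3, `h349`, `hGF`, (L5″), EX ∕ 19200 is proved here; no summit statement is proved by this seat.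

THE MATHEMATICS.  (§4) The window rows of B2b see only RATIOS of the weights, so B2b at the shifted pair `(φ − φ_c(y′), φ_c − φ_c(y′))` gives the decay `e^{φ_c(y_c i′) − φ_c(y_c i)}` for a
general column `i′` (no normalisation `φ_c(y_c i′) = 0`).  (§5) The fine spikes `(√c₀)⁻¹·toL2S(δ_x⊗E_{jk})` diagonalise every fine weight (px17 ✓`inner_spike_toL2S`), and the coarse
spikes are the `ι`-lifts of `(√c₁)⁻¹·δ_{σ z}⊗E_{jk}`, `σ = siteShift (sites_eq F n K h)` — so B2b's hypothesis-form bases `hbf`∕`hbc`∕`hcpl` are inhabited with `x_f = pr₁`, `y_c = σ∘pr₁`.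
(§6) With B3's pair at `y = σ i′.1` and slope `μ`: per-bond `|Δφ| ≤ μη` and in-block `|φ − φ_c∘B| ≤ 3μ` give the ratio rows with `ρ = e^{μη} − 1`, `ρ′ = e^{3μ} − 1`
(✓`abs_exp_sub_one_le`); `φ = 0` on `B(y)` and `μ(tdist z y − 3) ≤ φ` on `B(z)` give `φ_c(y) − φ_c(σ i.1) ≤ 9μ − μ·tdist(σ i.1, y)` (every block is inhabited, ✓`card_iterBlock`).

WHAT IS PROVED (ns `Summit.QuantumFields.YangMills.Theorems.Prop7CoarseGramInverseDecay`, continued).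
* §4 ★★ `norm_gram_inv_le_exp_sub` (B2b for a general column: `‖M⁻¹ i i′‖ ≤ (m_B²∕2 − 3ε²)⁻¹·e^{φ_c(y_c i′) − φ_c(y_c i)}`).
* §5 `spike_inner_weight_mul` (`hbf`), `spike_eq_lift` (`hbc`), `weight_smul_spikeFun_eq` (`hcpl`), ★★ `norm_gram_inv_spike_le_exp_sub` (B2b at the spike bases).
* §6 `abs_exp_div_sub_one_le` (ratio row from a difference row), ★★★ `norm_gram_inv_spike_le_exp_neg_tdist` (the `tdist` edition: `≤ (m_B²∕2 − 3ε(μ)²)⁻¹·e^{9μ}·e^{−μ·tdist(σ i.1, σ i′.1)}`).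

References: T. Bałaban, CMP **99** (1985) 389–434 [Balaban1985BackgroundPropagators] ((3.11) p.392, (3.16) p.393, Thm 3.1 (3.46) p.398, (3.49) p.399); CMP **116** (1988) 1–22
[Balaban1988RG2Cluster] ((2.7) p.13); S. Agmon (1982) Ch. 1 [folklore].
-/

set_option autoImplicit false

noncomputable section

open scoped BigOperators Matrix.Norms.L2Operator InnerProductSpace ComplexConjugate Matrix

namespace Summit.QuantumFields.YangMills.Theorems.Prop7CoarseGramInverseDecay

open Literature.MathematicalPhysics.QuantumFieldTheory.Balaban1983to89
open Finset
open T4Continuum BlockAveraging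
open BlockAveraging (Idx)
open B7Prop1Explicit (U1 disp)
open B5Eq118OneStroke (iterBlockOf iterBlock mem_iterBlock card_iterBlock)
open B10Eq27TorusAxialLog (holT transl)
open B7TransferAnalyticMean (meanCLM)
open B9Eq311L2Pairing (WL2)
open B11Eq103H1Complex (SiteL2K BondL2K)
open Summit.QuantumFields.YangMills.Theorems.Prop8Chart (emlIterU)
open Literature.MathematicalPhysics.QuantumFieldTheory.Balaban1983to89.T3ContinuumYM3Torus
open T3SectALandauChart (eta eta_pos bgUnits)
open T3PrintedRegularMinimiser (RegPr)
open T3PrintedRegularOrbits (sites_eq)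
open T3LevelShift (siteShift)
open Summit.QuantumFields.YangMills.Theorems.Prop7SectET3Transport (periodsT3)
open Summit.QuantumFields.YangMills.Theorems.Prop7SectET3HilbertLetters (W₂ toL2 toL2S DL2 DstarL2 covLapSite adjoint_DL2 inner_toL2)
open Summit.QuantumFields.YangMills.Theorems.Prop7SectET3RealCoordSums (inner_toL2S)
open Summit.QuantumFields.YangMills.Theorems.Prop7MassivePropagatorAgmonLetters (topMean_blockConst_smul inner_toL2S_smul_left norm_toL2S_smul_le)
open Summit.QuantumFields.YangMills.Theorems.Prop7MassiveConjugateResolvent (lift_topMean_weight_eq norm_weight_massive_inverse_sub_le)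
open Summit.QuantumFields.YangMills.Theorems.Prop7ComplementaryProjectorColumns (norm_adjoint_le)
open Summit.QuantumFields.YangMills.Theorems.Prop7GramConjAccretive (gram_inv_entry_decay)
open Summit.QuantumFields.YangMills.Theorems.Prop7SpanProjectorGramForm (gram_eq_conjTranspose_mul_coords)
open Summit.QuantumFields.YangMills.Theorems.Prop7SiteEntryCoordinates (orthonormal_spike top_le_span_spike inner_spike_toL2S norm_sq_sum_smul_orthonormalBasis)
open Summit.QuantumFields.YangMills.Theorems.Prop7BlockDistanceWeights (exists_blockDistanceWeight)
open Literature.MathematicalPhysics.QuantumFieldTheory.Balaban1983to89.Beta.CombesThomasForm (abs_exp_sub_one_le)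

variable (F : T3Family) {n K : ℕ} (h : n ≤ K) {c₀ c₁ : ℝ} [Fact (0 < c₀)] [Fact (0 < c₁)]
  {ε₀ : ℝ} (hε₀ : 0 < ε₀) (hε7 : 10 ^ 7 * (F.L : ℝ) ^ 3 * ε₀ ≤ 1)
  (U₀ : GaugeField (F.P K) 0 (Matrix.specialUnitaryGroup (Fin 2) ℂ)) (hreg : RegPr F n K ε₀ U₀)
  (Q'' : SiteL2K ℂ 3 (periodsT3 F K) c₀ W₂ →ₗ[ℂ] (Site (F.P K) (K - n) → Matrix (Fin 2) (Fin 2) ℂ))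
  (hseq : ∀ lam : Site (F.P K) 0 → Matrix (Fin 2) (Fin 2) ℂ, ∃ ns : (j : ℕ) → Site (F.P K) j → Matrix (Fin 2) (Fin 2) ℂ, ns 0 = lam ∧
      (∀ (j : ℕ) (y : Site (F.P K) (j + 1)), ns (j + 1) y = ns j (emb y) - meanCLM (Idx (F.P K)) (Matrix (Fin 2) (Fin 2) ℂ) fun i : Idx (F.P K) =>
        ns j (emb y) - ((holT (emlIterU j (bgUnits F K U₀)) (emb y) (stairWord i.2.1 (off i.1)) : (Matrix (Fin 2) (Fin 2) ℂ)ˣ) : Matrix (Fin 2) (Fin 2) ℂ) *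
          ns j (transl (emb y) (disp (stairWord i.2.1 (off i.1)))) * (((holT (emlIterU j (bgUnits F K U₀)) (emb y) (stairWord i.2.1 (off i.1)))⁻¹ : (Matrix (Fin 2) (Fin 2) ℂ)ˣ) : Matrix (Fin 2) (Fin 2) ℂ)) ∧
      ns (K - n) = Q'' (toL2S F K c₀ lam))
  (ι : (Site (F.P K) (K - n) → Matrix (Fin 2) (Fin 2) ℂ) →ₗ[ℂ] SiteL2K ℂ 3 (periodsT3 F n) c₁ W₂)
  (hι : ∀ c, ι c = toL2S F n c₁ (fun z => c (siteShift (sites_eq F n K h) z)))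
  (T : SiteL2K ℂ 3 (periodsT3 F n) c₁ W₂ →ₗ[ℂ] SiteL2K ℂ 3 (periodsT3 F K) c₀ W₂)
  (hT : ∀ (l : SiteL2K ℂ 3 (periodsT3 F K) c₀ W₂) (f : SiteL2K ℂ 3 (periodsT3 F n) c₁ W₂), ⟪ι (Q'' l), f⟫_ℂ = ⟪l, T f⟫_ℂ)
  {a : ℝ} (ha : 0 < a)
  (G : SiteL2K ℂ 3 (periodsT3 F K) c₀ W₂ →ₗ[ℂ] SiteL2K ℂ 3 (periodsT3 F K) c₀ W₂)
  (hAG : ∀ f, covLapSite F n K c₀ U₀ (G f) + (a : ℂ) • T (ι (Q'' (G f))) = f)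
  (hGA : ∀ u, G (covLapSite F n K c₀ U₀ u + (a : ℂ) • T (ι (Q'' u))) = u)

/-! ## §4 Shift invariance of the window: the decay for a general column `i′` -/

section Coordinates

variable {ιf ιc : Type*} [Fintype ιf] [Fintype ιc] [DecidableEq ιc]
  (bf : OrthonormalBasis ιf ℂ (SiteL2K ℂ 3 (periodsT3 F K) c₀ W₂)) (xf : ιf → Site (F.P K) 0)
  (hbf : ∀ (x : ιf) (w : Site (F.P K) 0 → ℝ) (g : Site (F.P K) 0 → Matrix (Fin 2) (Fin 2) ℂ),
    ⟪bf x, toL2S F K c₀ (fun s => w s • g s)⟫_ℂ = (w (xf x) : ℂ) * ⟪bf x, toL2S F K c₀ g⟫_ℂ)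
  (bc : OrthonormalBasis ιc ℂ (SiteL2K ℂ 3 (periodsT3 F n) c₁ W₂)) (cpl : ιc → Site (F.P K) (K - n) → Matrix (Fin 2) (Fin 2) ℂ)
  (yc : ιc → Site (F.P K) (K - n)) (hbc : ∀ i, bc i = ι (cpl i))
  (hcpl : ∀ (i : ιc) (g : Site (F.P K) (K - n) → ℝ), (fun y => g y • cpl i y) = fun y => g (yc i) • cpl i y)

include hε₀ hε7 hreg hseq hι hT ha hAG hbf hbc hcpl in
/-- ★★ **B2b FOR A GENERAL COLUMN**: under the hypotheses of ✓`norm_gram_inv_le_exp_neg_weight` but WITHOUT the normalisation `φ_c(y_c i′) = 0`,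
`‖M⁻¹ i i′‖ ≤ (m_B²∕2 − 3ε²)⁻¹ · e^{φ_c(y_c i′) − φ_c(y_c i)}` — the window rows `hwρ`∕`hwρ'` see only ratios `e^{φ(·)}∕e^{φ(·)}`, `e^{φ}∕e^{φ_c∘B}`, which are invariant under the
common shift `(φ, φ_c) ↦ (φ − φ_c(y_c i′), φ_c − φ_c(y_c i′))`. [cite: Balaban1985BackgroundPropagators, (3.49) p.399; Balaban1988RG2Cluster, (2.7) p.13] -/
theorem norm_gram_inv_le_exp_sub (φ : Site (F.P K) 0 → ℝ) (φc : Site (F.P K) (K - n) → ℝ)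
    {ρ ρ' : ℝ} (hρ : 0 ≤ ρ) (hρ' : 0 ≤ ρ')
    (hwρ : ∀ b : PBond (F.P K) 0, |Real.exp (φ b.tgt) / Real.exp (φ b.src) - 1| ≤ ρ ∧ |Real.exp (φ b.src) / Real.exp (φ b.tgt) - 1| ≤ ρ)
    (hwρ' : ∀ x : Site (F.P K) 0, |Real.exp (φ x) / Real.exp (φc (iterBlockOf (K - n) x)) - 1| ≤ ρ' ∧ |Real.exp (φc (iterBlockOf (K - n) x)) / Real.exp (φ x) - 1| ≤ ρ')
    {δ₁ : ℝ} (hδ₁ : 0 ≤ δ₁)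
    (hδ : 3 * ((eta F n K)⁻¹) ^ 2 * ρ ^ 2 + a * ((25 / 8) * (c₁ * ((((F.P K).L : ℝ) ^ (F.P K).d) ^ (K - n))⁻¹ / c₀)) * ρ' ^ 2 ≤ δ₁ ^ 2)
    (hwin : Real.sqrt (max 2 (16 * c₀ * ((F.L : ℝ) ^ (K - n)) ^ 3 / (a * c₁))) * δ₁ ≤ 1 / 10)
    {CT : ℝ} (hCT : 0 ≤ CT) (hCTb : ∀ l : SiteL2K ℂ 3 (periodsT3 F K) c₀ W₂, ‖ι (Q'' l)‖ ≤ CT * ‖l‖)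
    {CG : ℝ} (hCG : 0 ≤ CG) (hGn : ∀ f, ‖G f‖ ≤ CG * ‖f‖)
    {mB : ℝ} (hmB : 0 < mB) (hcoer : ∀ f : SiteL2K ℂ 3 (periodsT3 F n) c₁ W₂, mB * ‖f‖ ≤ ‖G (T f)‖)
    (hgap : 3 * ((Real.sqrt (max 2 (16 * c₀ * ((F.L : ℝ) ^ (K - n)) ^ 3 / (a * c₁))) * (2 + Real.sqrt (max 2 (16 * c₀ * ((F.L : ℝ) ^ (K - n)) ^ 3 / (a * c₁))))
          * (Real.sqrt 3 * (eta F n K)⁻¹ * ρ + (Real.sqrt 3 * (eta F n K)⁻¹ * ρ) ^ 2 + Real.sqrt a * CT * ρ' + a * CT ^ 2 * ρ' ^ 2)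
          * (8 * Real.sqrt (max 2 (16 * c₀ * ((F.L : ℝ) ^ (K - n)) ^ 3 / (a * c₁))) + 8 * Real.sqrt (max 2 (16 * c₀ * ((F.L : ℝ) ^ (K - n)) ^ 3 / (a * c₁))) ^ 2)
          * (CT * (1 + ρ')) + CG * (CT * ρ'))) ^ 2 < mB ^ 2 / 2)
    (i i' : ιc) :
    ‖(Matrix.of fun i i' : ιc => ⟪G (T (bc i)), G (T (bc i'))⟫_ℂ)⁻¹ i i'‖
      ≤ (mB ^ 2 / 2 - 3 * ((Real.sqrt (max 2 (16 * c₀ * ((F.L : ℝ) ^ (K - n)) ^ 3 / (a * c₁))) * (2 + Real.sqrt (max 2 (16 * c₀ * ((F.L : ℝ) ^ (K - n)) ^ 3 / (a * c₁))))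
          * (Real.sqrt 3 * (eta F n K)⁻¹ * ρ + (Real.sqrt 3 * (eta F n K)⁻¹ * ρ) ^ 2 + Real.sqrt a * CT * ρ' + a * CT ^ 2 * ρ' ^ 2)
          * (8 * Real.sqrt (max 2 (16 * c₀ * ((F.L : ℝ) ^ (K - n)) ^ 3 / (a * c₁))) + 8 * Real.sqrt (max 2 (16 * c₀ * ((F.L : ℝ) ^ (K - n)) ^ 3 / (a * c₁))) ^ 2)
          * (CT * (1 + ρ')) + CG * (CT * ρ'))) ^ 2)⁻¹ * Real.exp (φc (yc i') - φc (yc i)) := by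
  have hq : ∀ s t u : ℝ, Real.exp (s - u) / Real.exp (t - u) = Real.exp s / Real.exp t := by
    intro s t u
    rw [Real.exp_sub, Real.exp_sub, div_div_div_cancel_right₀ (Real.exp_ne_zero u)]
  have hmain := norm_gram_inv_le_exp_neg_weight F h hε₀ hε7 U₀ hreg Q'' hseq ι hι T hT ha G hAG bf xf hbf bc cpl yc hbc hcpl
    (fun s => φ s - φc (yc i')) (fun y => φc y - φc (yc i')) hρ hρ' (fun b => by simpa only [hq] using hwρ b)
    (fun x => by simpa only [hq] using hwρ' x) hδ₁ hδ hwin hCT hCTb hCG hGn hmB hcoer hgap i i' (sub_self _)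
  have he : -(φc (yc i) - φc (yc i')) = φc (yc i') - φc (yc i) := by ring
  rw [he] at hmain
  exact hmain

end Coordinates

/-! ## §5 The site⊗entry spike bases inhabit the coordinate hypotheses `hbf`, `hbc`, `hcpl` -/

/-- **FINE WEIGHTS ARE DIAGONAL ON THE FINE SPIKES** (`hbf` with `x_f = pr₁`): `⟪(√c₀)⁻¹·toL2S(δ_x⊗E_{jk}), toL2S(w·g)⟫ = w(x)·⟪(√c₀)⁻¹·toL2S(δ_x⊗E_{jk}), toL2S g⟫`
(px17 ✓`inner_spike_toL2S`). [cite: Balaban1985BackgroundPropagators, (3.11) p.392] -/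
theorem spike_inner_weight_mul (x : Site (F.P K) 0 × (Fin 2 × Fin 2)) (w : Site (F.P K) 0 → ℝ) (g : Site (F.P K) 0 → Matrix (Fin 2) (Fin 2) ℂ) :
    ⟪(OrthonormalBasis.mk (orthonormal_spike F) (top_le_span_spike F) : OrthonormalBasis (Site (F.P K) 0 × (Fin 2 × Fin 2)) ℂ (SiteL2K ℂ 3 (periodsT3 F K) c₀ W₂)) x, toL2S F K c₀ (fun s => w s • g s)⟫_ℂ
      = (w x.1 : ℂ) * ⟪(OrthonormalBasis.mk (orthonormal_spike F) (top_le_span_spike F) : OrthonormalBasis (Site (F.P K) 0 × (Fin 2 × Fin 2)) ℂ (SiteL2K ℂ 3 (periodsT3 F K) c₀ W₂)) x, toL2S F K c₀ g⟫_ℂ := by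
  simp only [OrthonormalBasis.coe_mk]
  rw [inner_spike_toL2S, inner_spike_toL2S]
  simp only [Matrix.smul_apply, Complex.real_smul]
  ring

include hι in
/-- **THE COARSE SPIKES ARE LIFTS OF ONE-SITE FUNCTIONS** (`hbc` with `cpl i = δ_{σ i.1}⊗((√c₁)⁻¹·E_{jk})`, `σ = siteShift (sites_eq F n K h)`): the reading `ι` (`hι`) composes
with the bijection `σ`, and `δ_{σ z₀}∘σ = δ_{z₀}`. [cite: Balaban1985BackgroundPropagators, (3.11) p.392, (3.16) p.393] -/
theorem spike_eq_lift (i : Site (F.P n) 0 × (Fin 2 × Fin 2)) :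
    (OrthonormalBasis.mk (orthonormal_spike F) (top_le_span_spike F) : OrthonormalBasis (Site (F.P n) 0 × (Fin 2 × Fin 2)) ℂ (SiteL2K ℂ 3 (periodsT3 F n) c₁ W₂)) i
      = ι (Pi.single (siteShift (sites_eq F n K h) i.1) ((((Real.sqrt c₁ : ℝ) : ℂ))⁻¹ • Matrix.single i.2.1 i.2.2 (1 : ℂ))) := by
  have hfun : (fun z : Site (F.P n) 0 =>
      (Pi.single (siteShift (sites_eq F n K h) i.1) ((((Real.sqrt c₁ : ℝ) : ℂ))⁻¹ • Matrix.single i.2.1 i.2.2 (1 : ℂ)) :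
        Site (F.P K) (K - n) → Matrix (Fin 2) (Fin 2) ℂ) (siteShift (sites_eq F n K h) z))
      = Pi.single i.1 ((((Real.sqrt c₁ : ℝ) : ℂ))⁻¹ • Matrix.single i.2.1 i.2.2 (1 : ℂ)) := by
    funext z
    by_cases hz : z = i.1
    · rw [hz, Pi.single_eq_same, Pi.single_eq_same]
    · rw [Pi.single_eq_of_ne hz]
      exact Pi.single_eq_of_ne ((siteShift (sites_eq F n K h)).injective.ne hz) _
  simp only [OrthonormalBasis.coe_mk]
  rw [hι, hfun, Pi.single_smul', map_smul]

omit [Fact (0 < c₁)] in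
/-- **COARSE WEIGHTS ARE DIAGONAL ON THE ONE-SITE FUNCTIONS** (`hcpl` with `y_c i = σ i.1`): `g·cpl i = g(σ i.1)·cpl i`. [cite: Balaban1985BackgroundPropagators, (3.16) p.393] -/
theorem weight_smul_spikeFun_eq (i : Site (F.P n) 0 × (Fin 2 × Fin 2)) (g : Site (F.P K) (K - n) → ℝ) :
    (fun y => g y • (Pi.single (siteShift (sites_eq F n K h) i.1) ((((Real.sqrt c₁ : ℝ) : ℂ))⁻¹ • Matrix.single i.2.1 i.2.2 (1 : ℂ)) :
        Site (F.P K) (K - n) → Matrix (Fin 2) (Fin 2) ℂ) y)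
      = fun y => g (siteShift (sites_eq F n K h) i.1) • (Pi.single (siteShift (sites_eq F n K h) i.1) ((((Real.sqrt c₁ : ℝ) : ℂ))⁻¹ • Matrix.single i.2.1 i.2.2 (1 : ℂ)) :
        Site (F.P K) (K - n) → Matrix (Fin 2) (Fin 2) ℂ) y := by
  funext y
  by_cases hy : y = siteShift (sites_eq F n K h) i.1
  · rw [hy]
  · rw [Pi.single_eq_of_ne hy, smul_zero, smul_zero]

include hε₀ hε7 hreg hseq hι hT ha hAG in
/-- ★★ **B2b AT THE SPIKE BASES**: with `b_c` px17's site⊗entry spike basis of the coarse space (`OrthonormalBasis.mk (orthonormal_spike F) (top_le_span_spike F)`) and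
`M i i′ = ⟪G(T(b_c i)), G(T(b_c i′))⟫`, for every weight pair `(φ, φ_c)` in the window: `‖M⁻¹ i i′‖ ≤ (m_B²∕2 − 3ε²)⁻¹ · e^{φ_c(σ i′.1) − φ_c(σ i.1)}`, `σ = siteShift (sites_eq F n K h)`.
[cite: Balaban1985BackgroundPropagators, (3.11) p.392, (3.49) p.399; Balaban1988RG2Cluster, (2.7) p.13] -/
theorem norm_gram_inv_spike_le_exp_sub (φ : Site (F.P K) 0 → ℝ) (φc : Site (F.P K) (K - n) → ℝ)
    {ρ ρ' : ℝ} (hρ : 0 ≤ ρ) (hρ' : 0 ≤ ρ')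
    (hwρ : ∀ b : PBond (F.P K) 0, |Real.exp (φ b.tgt) / Real.exp (φ b.src) - 1| ≤ ρ ∧ |Real.exp (φ b.src) / Real.exp (φ b.tgt) - 1| ≤ ρ)
    (hwρ' : ∀ x : Site (F.P K) 0, |Real.exp (φ x) / Real.exp (φc (iterBlockOf (K - n) x)) - 1| ≤ ρ' ∧ |Real.exp (φc (iterBlockOf (K - n) x)) / Real.exp (φ x) - 1| ≤ ρ')
    {δ₁ : ℝ} (hδ₁ : 0 ≤ δ₁)
    (hδ : 3 * ((eta F n K)⁻¹) ^ 2 * ρ ^ 2 + a * ((25 / 8) * (c₁ * ((((F.P K).L : ℝ) ^ (F.P K).d) ^ (K - n))⁻¹ / c₀)) * ρ' ^ 2 ≤ δ₁ ^ 2)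
    (hwin : Real.sqrt (max 2 (16 * c₀ * ((F.L : ℝ) ^ (K - n)) ^ 3 / (a * c₁))) * δ₁ ≤ 1 / 10)
    {CT : ℝ} (hCT : 0 ≤ CT) (hCTb : ∀ l : SiteL2K ℂ 3 (periodsT3 F K) c₀ W₂, ‖ι (Q'' l)‖ ≤ CT * ‖l‖)
    {CG : ℝ} (hCG : 0 ≤ CG) (hGn : ∀ f, ‖G f‖ ≤ CG * ‖f‖)
    {mB : ℝ} (hmB : 0 < mB) (hcoer : ∀ f : SiteL2K ℂ 3 (periodsT3 F n) c₁ W₂, mB * ‖f‖ ≤ ‖G (T f)‖)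
    (hgap : 3 * ((Real.sqrt (max 2 (16 * c₀ * ((F.L : ℝ) ^ (K - n)) ^ 3 / (a * c₁))) * (2 + Real.sqrt (max 2 (16 * c₀ * ((F.L : ℝ) ^ (K - n)) ^ 3 / (a * c₁))))
          * (Real.sqrt 3 * (eta F n K)⁻¹ * ρ + (Real.sqrt 3 * (eta F n K)⁻¹ * ρ) ^ 2 + Real.sqrt a * CT * ρ' + a * CT ^ 2 * ρ' ^ 2)
          * (8 * Real.sqrt (max 2 (16 * c₀ * ((F.L : ℝ) ^ (K - n)) ^ 3 / (a * c₁))) + 8 * Real.sqrt (max 2 (16 * c₀ * ((F.L : ℝ) ^ (K - n)) ^ 3 / (a * c₁))) ^ 2)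
          * (CT * (1 + ρ')) + CG * (CT * ρ'))) ^ 2 < mB ^ 2 / 2)
    (i i' : Site (F.P n) 0 × (Fin 2 × Fin 2)) :
    ‖(Matrix.of fun i i' : Site (F.P n) 0 × (Fin 2 × Fin 2) => ⟪G (T ((OrthonormalBasis.mk (orthonormal_spike F) (top_le_span_spike F) : OrthonormalBasis (Site (F.P n) 0 × (Fin 2 × Fin 2)) ℂ (SiteL2K ℂ 3 (periodsT3 F n) c₁ W₂)) i)), G (T ((OrthonormalBasis.mk (orthonormal_spike F) (top_le_span_spike F) : OrthonormalBasis (Site (F.P n) 0 × (Fin 2 × Fin 2)) ℂ (SiteL2K ℂ 3 (periodsT3 F n) c₁ W₂)) i'))⟫_ℂ)⁻¹ i i'‖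
      ≤ (mB ^ 2 / 2 - 3 * ((Real.sqrt (max 2 (16 * c₀ * ((F.L : ℝ) ^ (K - n)) ^ 3 / (a * c₁))) * (2 + Real.sqrt (max 2 (16 * c₀ * ((F.L : ℝ) ^ (K - n)) ^ 3 / (a * c₁))))
          * (Real.sqrt 3 * (eta F n K)⁻¹ * ρ + (Real.sqrt 3 * (eta F n K)⁻¹ * ρ) ^ 2 + Real.sqrt a * CT * ρ' + a * CT ^ 2 * ρ' ^ 2)
          * (8 * Real.sqrt (max 2 (16 * c₀ * ((F.L : ℝ) ^ (K - n)) ^ 3 / (a * c₁))) + 8 * Real.sqrt (max 2 (16 * c₀ * ((F.L : ℝ) ^ (K - n)) ^ 3 / (a * c₁))) ^ 2)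
          * (CT * (1 + ρ')) + CG * (CT * ρ'))) ^ 2)⁻¹ * Real.exp (φc (siteShift (sites_eq F n K h) i'.1) - φc (siteShift (sites_eq F n K h) i.1)) := by
  classical
  exact norm_gram_inv_le_exp_sub F h hε₀ hε7 U₀ hreg Q'' hseq ι hι T hT ha G hAG (OrthonormalBasis.mk (orthonormal_spike F) (top_le_span_spike F) : OrthonormalBasis (Site (F.P K) 0 × (Fin 2 × Fin 2)) ℂ (SiteL2K ℂ 3 (periodsT3 F K) c₀ W₂)) Prod.fst (spike_inner_weight_mul F) (OrthonormalBasis.mk (orthonormal_spike F) (top_le_span_spike F) : OrthonormalBasis (Site (F.P n) 0 × (Fin 2 × Fin 2)) ℂ (SiteL2K ℂ 3 (periodsT3 F n) c₁ W₂))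
    (fun i => Pi.single (siteShift (sites_eq F n K h) i.1) ((((Real.sqrt c₁ : ℝ) : ℂ))⁻¹ • Matrix.single i.2.1 i.2.2 (1 : ℂ)))
    (fun i => siteShift (sites_eq F n K h) i.1) (spike_eq_lift F h ι hι) (weight_smul_spikeFun_eq F h) φ φc hρ hρ' hwρ hwρ' hδ₁ hδ hwin hCT hCTb hCG hGn hmB hcoer hgap i i'

/-! ## §6 The `tdist` edition with px12's block-distance Agmon weights -/

/-- A difference row `|s − t| ≤ θ` gives the two ratio rows `|e^s∕e^t − 1| ≤ e^θ − 1`, `|e^t∕e^s − 1| ≤ e^θ − 1` (✓`abs_exp_sub_one_le`). [folklore] -/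
theorem abs_exp_div_sub_one_le {s t θ : ℝ} (hst : |s - t| ≤ θ) :
    |Real.exp s / Real.exp t - 1| ≤ Real.exp θ - 1 ∧ |Real.exp t / Real.exp s - 1| ≤ Real.exp θ - 1 := by
  rw [← Real.exp_sub, ← Real.exp_sub]
  exact ⟨abs_exp_sub_one_le hst, abs_exp_sub_one_le (by rwa [abs_sub_comm])⟩

include hε₀ hε7 hreg hseq hι hT ha hAG in
/-- ★★★ **THE INVERSE COARSE GRAM MATRIX OF THE MASSIVE SPIKE COLUMNS DECAYS EXPONENTIALLY IN THE COARSE TORUS DISTANCE**: for every slope `μ ≥ 0` with the window rows at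
`ρ = e^{μη} − 1`, `ρ′ = e^{3μ} − 1` (`η = eta F n K`; note `η⁻¹ρ ≈ μ`, K-uniformly) and the gap `3ε(μ)² < m_B²∕2`,
`‖M⁻¹ i i′‖ ≤ (m_B²∕2 − 3ε(μ)²)⁻¹ · e^{9μ} · e^{−μ·tdist(σ i.1, σ i′.1)}` — ✓`norm_gram_inv_spike_le_exp_sub` at px12's ✓`exists_blockDistanceWeight` pair for `y = σ i′.1`.
This is the `hN` row (`C_N = (m_B²∕2 − 3ε²)⁻¹e^{9μ}`, rate `μ`) of ✓`norm_form_sandwich_le_exp` ∕ ✓`norm_inner_starProjection_le_exp` for print's `P = 1 − R_{Q″}` in the massive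
spike columns (✓`sub_projR_eq_gramSum`), CONDITIONAL on `hcoer` ((L4′)). [cite: Balaban1985BackgroundPropagators, Thm 3.1 (3.46) p.398, (3.49) p.399; Balaban1988RG2Cluster, (2.7) p.13] -/
theorem norm_gram_inv_spike_le_exp_neg_tdist {μ : ℝ} (hμ : 0 ≤ μ)
    {δ₁ : ℝ} (hδ₁ : 0 ≤ δ₁)
    (hδ : 3 * ((eta F n K)⁻¹) ^ 2 * (Real.exp (μ * eta F n K) - 1) ^ 2 + a * ((25 / 8) * (c₁ * ((((F.P K).L : ℝ) ^ (F.P K).d) ^ (K - n))⁻¹ / c₀)) * (Real.exp (3 * μ) - 1) ^ 2 ≤ δ₁ ^ 2)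
    (hwin : Real.sqrt (max 2 (16 * c₀ * ((F.L : ℝ) ^ (K - n)) ^ 3 / (a * c₁))) * δ₁ ≤ 1 / 10)
    {CT : ℝ} (hCT : 0 ≤ CT) (hCTb : ∀ l : SiteL2K ℂ 3 (periodsT3 F K) c₀ W₂, ‖ι (Q'' l)‖ ≤ CT * ‖l‖)
    {CG : ℝ} (hCG : 0 ≤ CG) (hGn : ∀ f, ‖G f‖ ≤ CG * ‖f‖)
    {mB : ℝ} (hmB : 0 < mB) (hcoer : ∀ f : SiteL2K ℂ 3 (periodsT3 F n) c₁ W₂, mB * ‖f‖ ≤ ‖G (T f)‖)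
    (hgap : 3 * ((Real.sqrt (max 2 (16 * c₀ * ((F.L : ℝ) ^ (K - n)) ^ 3 / (a * c₁))) * (2 + Real.sqrt (max 2 (16 * c₀ * ((F.L : ℝ) ^ (K - n)) ^ 3 / (a * c₁))))
          * (Real.sqrt 3 * (eta F n K)⁻¹ * (Real.exp (μ * eta F n K) - 1) + (Real.sqrt 3 * (eta F n K)⁻¹ * (Real.exp (μ * eta F n K) - 1)) ^ 2 + Real.sqrt a * CT * (Real.exp (3 * μ) - 1) + a * CT ^ 2 * (Real.exp (3 * μ) - 1) ^ 2)
          * (8 * Real.sqrt (max 2 (16 * c₀ * ((F.L : ℝ) ^ (K - n)) ^ 3 / (a * c₁))) + 8 * Real.sqrt (max 2 (16 * c₀ * ((F.L : ℝ) ^ (K - n)) ^ 3 / (a * c₁))) ^ 2)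
          * (CT * (1 + (Real.exp (3 * μ) - 1))) + CG * (CT * (Real.exp (3 * μ) - 1)))) ^ 2 < mB ^ 2 / 2)
    (i i' : Site (F.P n) 0 × (Fin 2 × Fin 2)) :
    ‖(Matrix.of fun i i' : Site (F.P n) 0 × (Fin 2 × Fin 2) => ⟪G (T ((OrthonormalBasis.mk (orthonormal_spike F) (top_le_span_spike F) : OrthonormalBasis (Site (F.P n) 0 × (Fin 2 × Fin 2)) ℂ (SiteL2K ℂ 3 (periodsT3 F n) c₁ W₂)) i)), G (T ((OrthonormalBasis.mk (orthonormal_spike F) (top_le_span_spike F) : OrthonormalBasis (Site (F.P n) 0 × (Fin 2 × Fin 2)) ℂ (SiteL2K ℂ 3 (periodsT3 F n) c₁ W₂)) i'))⟫_ℂ)⁻¹ i i'‖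
      ≤ (mB ^ 2 / 2 - 3 * ((Real.sqrt (max 2 (16 * c₀ * ((F.L : ℝ) ^ (K - n)) ^ 3 / (a * c₁))) * (2 + Real.sqrt (max 2 (16 * c₀ * ((F.L : ℝ) ^ (K - n)) ^ 3 / (a * c₁))))
          * (Real.sqrt 3 * (eta F n K)⁻¹ * (Real.exp (μ * eta F n K) - 1) + (Real.sqrt 3 * (eta F n K)⁻¹ * (Real.exp (μ * eta F n K) - 1)) ^ 2 + Real.sqrt a * CT * (Real.exp (3 * μ) - 1) + a * CT ^ 2 * (Real.exp (3 * μ) - 1) ^ 2)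
          * (8 * Real.sqrt (max 2 (16 * c₀ * ((F.L : ℝ) ^ (K - n)) ^ 3 / (a * c₁))) + 8 * Real.sqrt (max 2 (16 * c₀ * ((F.L : ℝ) ^ (K - n)) ^ 3 / (a * c₁))) ^ 2)
          * (CT * (1 + (Real.exp (3 * μ) - 1))) + CG * (CT * (Real.exp (3 * μ) - 1)))) ^ 2)⁻¹ * Real.exp (9 * μ)
          * Real.exp (-(μ * (Site.tdist (P := F.P K) (siteShift (sites_eq F n K h) i.1) (siteShift (sites_eq F n K h) i'.1) : ℝ))) := by
  classical
  obtain ⟨φ, φc, -, hbond, -, hosc, hzero, hfar⟩ := exists_blockDistanceWeight F h (siteShift (sites_eq F n K h) i'.1) hμ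
  have hη : 0 < eta F n K := eta_pos F n K
  have hρ : 0 ≤ Real.exp (μ * eta F n K) - 1 := by
    have := Real.one_le_exp (mul_nonneg hμ hη.le); linarith
  have hρ' : 0 ≤ Real.exp (3 * μ) - 1 := by
    have := Real.one_le_exp (by positivity : 0 ≤ 3 * μ); linarith
  have hwρ : ∀ b : PBond (F.P K) 0, |Real.exp (φ b.tgt) / Real.exp (φ b.src) - 1| ≤ Real.exp (μ * eta F n K) - 1 ∧
      |Real.exp (φ b.src) / Real.exp (φ b.tgt) - 1| ≤ Real.exp (μ * eta F n K) - 1 := fun b => abs_exp_div_sub_one_le (hbond b)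
  have hwρ' : ∀ x : Site (F.P K) 0, |Real.exp (φ x) / Real.exp (φc (iterBlockOf (K - n) x)) - 1| ≤ Real.exp (3 * μ) - 1 ∧
      |Real.exp (φc (iterBlockOf (K - n) x)) / Real.exp (φ x) - 1| ≤ Real.exp (3 * μ) - 1 := fun x => abs_exp_div_sub_one_le (hosc x)
  have hmain := norm_gram_inv_spike_le_exp_sub F h hε₀ hε7 U₀ hreg Q'' hseq ι hι T hT ha G hAG φ φc hρ hρ' hwρ hwρ' hδ₁ hδ hwin hCT hCTb hCG hGn hmB hcoer hgap i i'
  -- every block is inhabited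
  have hk : K - n ≤ (F.P K).m + (F.P K).K := by show K - n ≤ F.m + K; omega
  have hrep : ∀ z : Site (F.P K) (K - n), ∃ r : Site (F.P K) 0, iterBlockOf (K - n) r = z := fun z => by
    have hne : (iterBlock (K - n) z).Nonempty := by
      rw [← Finset.card_pos, card_iterBlock (K - n) hk]; exact pow_pos (pow_pos (F.P K).L_pos _) _
    obtain ⟨r, hr⟩ := hne
    exact ⟨r, (mem_iterBlock _ _ _).mp hr⟩
  obtain ⟨x', hx'⟩ := hrep (siteShift (sites_eq F n K h) i'.1)
  obtain ⟨x, hx⟩ := hrep (siteShift (sites_eq F n K h) i.1)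
  have h1 : φc (siteShift (sites_eq F n K h) i'.1) ≤ 3 * μ := by
    have ho := (abs_le.1 (hosc x')).1
    rw [hx', hzero x' hx'] at ho
    linarith
  have h2 : μ * (Site.tdist (P := F.P K) (siteShift (sites_eq F n K h) i.1) (siteShift (sites_eq F n K h) i'.1) : ℝ) - 6 * μ ≤ φc (siteShift (sites_eq F n K h) i.1) := by
    have ho := (abs_le.1 (hosc x)).2
    rw [hx] at ho
    have hf := hfar _ x hx
    rw [mul_sub] at hf
    linarith
  have hexp : Real.exp (φc (siteShift (sites_eq F n K h) i'.1) - φc (siteShift (sites_eq F n K h) i.1))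
      ≤ Real.exp (9 * μ) * Real.exp (-(μ * (Site.tdist (P := F.P K) (siteShift (sites_eq F n K h) i.1) (siteShift (sites_eq F n K h) i'.1) : ℝ))) := by
    rw [← Real.exp_add]
    exact Real.exp_le_exp.2 (by linarith [h1, h2])
  calc _ ≤ _ := hmain
    _ ≤ _ * (Real.exp (9 * μ) * Real.exp (-(μ * (Site.tdist (P := F.P K) (siteShift (sites_eq F n K h) i.1) (siteShift (sites_eq F n K h) i'.1) : ℝ)))) :=
        mul_le_mul_of_nonneg_left hexp (le_of_lt (inv_pos.2 (sub_pos.2 hgap)))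
    _ = _ := (mul_assoc _ _ _).symm

end Summit.QuantumFields.YangMills.Theorems.Prop7CoarseGramInverseDecay

end
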